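import Mathlib.LinearAlgebra.Projection
import Mathlib.LinearAlgebra.Span.Basic
import Mathlib.LinearAlgebra.Dimension.FreeAndStrongRankCondition
import Mathlib.RingTheory.Ideal.Maximal
import Mathlib.Algebra.Algebra.Basic
import HarnessLib

/-!
# Kato 2004 (Astérisque 295) §15.8, §15.10 and Lemma 15.11: the Galois representation of a CM newform
# as an INDUCED representation `V_λ(f) ≅ V_λ(ψ) ⊕ ιV_λ(ψ)`, the UNIQUENESS mechanism of the λ-adic and
# Betti identifications (15.11.2)/(15.11.3), and the lattice chain `πS′ ⊆ T ⊆ S′` at the split vertex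
# — the ALGEBRA of these paragraphs, PROVED; no named fact

Topic `NumberTheory/EllipticCurves`, sub-directory `Kato2004` (namespace = path; grouping sub-namespace
`CMInduced`).  Typed by seat `bsd-cm-prr-ty1` g27 (literature-prover, cell bsd-cm) on the planner's row
(GENUS-LIT-2: CM / KATO COLUMN), file (F6) of the typing map `GenusTypingMap-g57.md` REV 1.1 rows C3–C4 for
the frozen proof-memo `MEMO-bsd-cm-genus.md` REV 1 (a38f3eedd2c92d58) §4 LATTICE LEMMA and §5 «k = 2
COMPATIBILITY» (crux `EllipticUnitValueSevenOfGZK` = stmt-BirchSwinnertonDyer-19945, road R2).  ONE source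
section — K. Kato, *p-adic Hodge theory and values of zeta functions of modular forms*, Astérisque 295 (2004),
**§15.8 (pp. 256–257), §15.10 (p. 260), Lemma 15.11 with its proof (pp. 260–262) and the remark after it
(p. 263)** [Kato2004Asterisque] (held text `paper:doi-10-24033-ast-639`, PDF pages p0141–p0148 = printed page
− 115; read 2026-08-30 by this seat; the OCR of the displays is poor and the displays below are reconstructed
from the prose and from the frozen memo §1 (N6), §5, whose author and critic read the same pages).
HONEST FRAMING: this file proves ALGEBRA — the two-line mechanism of Kato's proof of Lemma 15.11 on its three
inputs, the idempotent book-keeping behind 15.10 in the elliptic-curve frame, and folklore lattice lemmas —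
and asserts NOTHING arithmetic: no named fact (`def … : Prop`) is introduced (net debt 0); nothing about an
elliptic curve, a zeta element or BSD is claimed; no summit statement is touched.

## The printed statements

* **§15.8 [pp. 256–257]** "Let `r ≥ 1`, and let `ψ` be a Hecke character of `K` of type `(−r, 0)`. … Let `L`
  be the subfield of `ℂ` generated by `ψ(K^×)` over `K` … we define one dimensional `L`-vector spaces
  `V_L(ψ)` and `S(ψ)`, and a continuous `L_λ`-linear action of `Gal(K^{ab}/K)` on `V_{L_λ}(ψ) = V_L(ψ) ⊗_L L_λ`
  for each finite place `λ` of `L`. We define also an `L`-linear map `per_ψ : S(ψ) → V_L(ψ) ⊗_L ℂ` called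
  the period map, and an isomorphism **(15.8.1)** `D^j_dR(K ⊗ ℚ_p, V_{L_λ}(ψ)) ≅ S(ψ) ⊗_L L_λ` (`1 ≤ j ≤ r`) …
  `V_L(ψ) = H¹(E(ℂ), ℚ)^{⊗r} ⊗_K L`" (for the canonical CM-pair `(E, α)` over `K(𝔣)`, §15.3), "This action of
  `Gal(ℚ̄/K)` on `V_{L_λ}(ψ)` is abelian … for an ideal `𝔞` of `O_K` which is prime to `p𝔣`, `(𝔞, K(p^∞𝔣)/K)`
  acts on `V_{L_λ}(ψ)` as the multiplication by `ψ(𝔞)⁻¹`."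
* **§15.10 [p. 260]** "In the rest of §15, assume `f` has CM. Then `L(f, s) = L(ψ, s)` for a Hecke character
  `ψ` of an imaginary quadratic field `K` of type `(1 − k, 0)` whose conductor divides `N`. … Let `λ` be a
  finite place of `L`. Then, as a representation of `Gal(ℚ̄/ℚ)` over `L_λ`, `V_{L_λ}(f)` is isomorphic to the
  representation `V_{L_λ}(ψ) ⊕ ιV_{L_λ}(ψ)` induced from the representation `V_{L_λ}(ψ)` of the subgroup
  `Gal(ℚ̄/K)` of `Gal(ℚ̄/ℚ)`. Here `ι ∈ Gal(ℚ̄/ℚ)` denotes the complex conjugation, and the action of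
  `σ ∈ Gal(ℚ̄/ℚ)` on `V_{L_λ}(ψ) ⊕ ιV_{L_λ}(ψ)` sends `(x, ιy)` to `(σ(x), ι(ισι)(y))` if `σ` belongs to
  `Gal(ℚ̄/K)`, and to `((σι)(y), ι(ισ)(x))` if `σ ∉ Gal(ℚ̄/K)`. This can be seen by comparing the
  eigenpolynomial of Frobenius of each prime number which is prime to `N`. (See [Ri2].)"
* **Lemma 15.11 [pp. 260–261]** "Fix an isomorphism of one dimensional `L`-vector spaces **(15.11.1)**
  `S(ψ) ≅ S(f) ⊗_F L`. Then: (1) For each finite place `λ` of `L`, there exists a unique isomorphism of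
  representations of `Gal(ℚ̄/ℚ)` over `L_λ` **(15.11.2)** `V_{L_λ}(ψ) ⊕ ιV_{L_λ}(ψ) ≅ V_{L_λ}(f)` such that the
  composition `S(ψ) ⊗_L L_λ ≅ D^1_dR(K ⊗ ℚ_p, V_{L_λ}(ψ)) = D^1_dR(ℚ_p, V_{L_λ}(ψ) ⊕ ιV_{L_λ}(ψ)) →(15.11.2)
  D^1_dR(ℚ_p, V_{L_λ}(f)) ≅ S(f) ⊗_F L_λ` coincides with the isomorphism induced by (15.11.1). (2) Let
  `V_L(ψ)~ = V_L(ψ) ⊕ ιV_L(ψ)` (`ι` = the complex conjugation) be the representation of `Gal(ℂ/ℝ)` over `L`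
  induced from the trivial representation `V_L(ψ)` of the subgroup `{1}` of `Gal(ℂ/ℝ)`, and denote the
  composite `S(ψ) → V_L(ψ) ⊗_L ℂ ⊂ V_L(ψ)~ ⊗_L ℂ` also by `per_ψ`. Then there exists a unique isomorphism of
  representations of `Gal(ℂ/ℝ)` over `L` **(15.11.3)** `V_L(ψ)~ ≅ V_L(f)` for which the diagram [`per_ψ` on
  `S(ψ)`, (15.11.1), `per_f` on `S(f) ⊗_F L`] is commutative."
* **Proof [pp. 261–262]** "(1) Take any isomorphism `h : V_{L_λ}(ψ)~ ≅ V_{L_λ}(f)` of representations of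
  `Gal(ℚ̄/ℚ)` over `L_λ`. Then `h` induces `D^1_dR(V_{L_λ}(ψ)~) ≅ D^1_dR(V_{L_λ}(f))` and hence
  `S(ψ) ⊗_L L_λ ≅ S(f) ⊗_F L_λ` which is `c` times the isomorphism induced by (15.11.1) for some `c ∈ L_λ^×`.
  The isomorphism `c⁻¹h` is the desired one. The uniqueness follows from the irreducibility of `V_{L_λ}(ψ)~`
  [sic; = `V_{L_λ}(f)`] as a representation of `Gal(ℚ̄/ℚ)` over `L_λ`. (2) Fix a sign `±` … it is sufficient
  to show that there exists an isomorphism of one dimensional `L`-vector spaces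
  `h : V_L(ψ) ≅ V_L(f)^±` such that `h ∘ per_ψ^± = per_f^±` … [by 6.6, 13.5 and (15.9.2): a non-vanishing
  twisted `L`-value gives `b ∈ L^×`]."  **Remark [p. 263]** "The 'philosophy of motif' tells that the
  isomorphism (15.11.3) should be compatible with our identification (15.11.2), but I can not prove it. …
  So to avoid the confusion, we will never use (15.11.3) as identification.  … In the rest of §15 … we
  identify `S(ψ)` and `S(f) ⊗_F L` via (15.11.1) … and `V_{L_λ}(ψ)~` and `V_{L_λ}(f)` via (15.11.2)."

## What is typed, and why it is the printed content (design; reviewer: read this first)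

* **(D1) Lemma 15.11 is a MECHANISM on three inputs, and the mechanism is a theorem.**  Kato's proof of
  (1) uses exactly: (i) SOME `Gal(ℚ̄/ℚ)`-isomorphism `h₀ : V_{L_λ}(ψ)~ ≅ V_{L_λ}(f)` exists (= 15.10, the
  arithmetic input, [Ri2] = Ribet); (ii) any two such isomorphisms differ by a scalar `c ∈ L_λ^×` ("the
  uniqueness follows from the irreducibility" = Schur's lemma for the absolutely irreducible `V_{L_λ}(f)`);
  (iii) `h ↦ D^1_dR(h)` is `L_λ^×`-EQUIVARIANT (`D(c·h) = c·D(h)`, functoriality of `D_dR`) with values in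
  the isomorphisms between two LINES, on which `L_λ^×` acts freely and transitively.  From (i)–(iii) the
  conclusion "for the fixed (15.11.1) there is a UNIQUE `h` with `D(h)` = (15.11.1)" is two lines of algebra;
  clause (2) has the same shape with `Gal(ℂ/ℝ)`, `per` and Kato's `L`-value argument supplying (i).  §3
  below PROVES this mechanism once, abstractly: `existsUnique_of_equivariant` (an equivariant map from a
  homogeneous `U`-set to a `U`-torsor hits every point exactly once) together with the two facts about
  LINES that make the target a torsor (`exists_unit_smul_eq_of_finrank_eq_one`: two isomorphisms onto a
  one-dimensional space differ by a unit; `unit_eq_one_of_smul_equiv_eq`: freeness).  The inputs (i)–(ii)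
  are HYPOTHESES of these theorems, to be supplied by the consumer in its frame; NO named fact is minted
  for them here (D-0026), because in the only frame the tree consumes — an elliptic curve `W/ℚ` with complex
  multiplication by `O_K`, `k = 2`, `F = ℚ`, `L = K`, `λ = 𝔭`, the frame of the frozen memo §1 (N6) — input
  (i) is NOT Ribet's theorem but the elementary eigen-decomposition (D2), and input (ii) is Schur's lemma
  for `V_pW ⊗ K_𝔭` (the induced representation of a character `ψ` with `ψ ≠ ψ∘ι`: an equivariant
  endomorphism preserves the two eigenlines (D2) and is scalar on each, with equal scalars because it
  commutes with `ι` — again eigen-line calculus, no arithmetic).  For general weight `k ≥ 3`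
  the objects `V_{L_λ}(f)`, `D^1_dR`, `S(f)` are not in the tree and 15.10 stays untyped:
  -- TODO(general form): Kato 15.10 / 15.11 for CM newforms of weight `k ≥ 2` with coefficients, over the
  -- motives `V_L(f)`, `V_L(ψ)`, with `D_dR` and the period maps as objects (Mathlib has none of them).
* **(D2) 15.10 in the elliptic-curve frame is idempotent calculus (§1, PROVED).**  For `W/ℚ` with CM by
  `K` all endomorphisms are defined over `K`, so `Γ_K` commutes with the CM endomorphism `G = T_p(φ)` on
  `V = V_pW` (tree theorem `WeierstrassCurve.commute_rationalGaloisRepTate_of_hasRationalCM`, file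
  `DivisionTowerAbelianOfRationalCMProofs.lean`, Serre IV.2.2), and an element of `Γ_ℚ ∖ Γ_K` conjugates
  `G` to `Ḡ = t − G` (`φ^σ = φ̄`).  Over a field `F ⊇ ℚ_p` containing the two roots `a ≠ b` of the
  characteristic polynomial `X² − tX + n` of `G` (for the memo: `F = K_𝔭 = ℚ₇(√−7)`, `G² = −7`,
  `a, b = ±√−7`), §1 builds the idempotent `e = (a − b)⁻¹(G − b)` (`cmIdempotent`; `cmIdempotent_isIdempotentElem`),
  shows `G e = a e`, `G (1 − e) = b (1 − e)` (the two EIGENLINES `𝒱′_ψ = range e`, `𝒱′_{ψ∘ι} = ker e`,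
  complementary: Mathlib `LinearMap.IsIdempotentElem.isCompl`), that every operator commuting with `G`
  preserves both (`map_range_le_of_commute`, `map_ker_le_of_commute` — the `Γ_K`-stability, i.e. `Γ_K` acts
  on each line through a CHARACTER), and that an operator `σ` with `σG = (t − G)σ` SWAPS them
  (`conj_cmIdempotent_of_anticommute`, `map_range_le_ker_of_anticommute`) — which is the sentence
  "`V_{L_λ}(f) ≅ V_{L_λ}(ψ) ⊕ ιV_{L_λ}(ψ)`, `σ ∉ Gal(ℚ̄/K)` sends `(x, ιy)` to `((σι)(y), ι(ισ)(x))`" read on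
  `𝒱′ = V_pW ⊗_{ℚ_p} K_𝔭`.  (Mathlib's abstract induced representation is `Representation.ind`; Kato's
  explicit two-summand model is the one the memo uses, and it is what §1 types.)
* **(D3) The lattice chain at the split vertex (§2, PROVED; memo §4 (L1)–(L3); folklore — the
  `Gal`-stable lattices of a residually multiplicity-free two-dimensional representation over a discrete
  valuation ring form a segment of the Bruhat–Tits tree, cf. Serre, *Abelian ℓ-adic representations* I.1
  and Bellaïche–Chenevier, Astérisque 324, §1.2).**  Over `O ⊆ F` (`Algebra O F`; for the memo
  `O_𝔭 = ℤ₇[√−7] ⊂ K_𝔭`, uniformiser `π = √−7`), for an `O`-submodule `L ⊆ 𝒱′` (a lattice `T_W^O = T_pW ⊗ O_𝔭`)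
  the SPLIT HULL `splitHull e L := e(L) + (1 − e)(L)` (`= pr_ψ L ⊕ pr_{ψ∘ι} L`, memo (L1) `M⁺`) contains `L`
  (`le_splitHull`), is split (`map_le_splitHull_left/right`), is stable under every `F`-linear operator that
  preserves `L` and commutes with `e` (`map_splitHull_le_of_commute`) or anti-commutes with it
  (`map_splitHull_le_of_anticommute`), and — the one arithmetic input, as a HYPOTHESIS — if SOME operator `g`
  preserving `L` acts on the two lines by scalars `a, b ∈ O` with `a − b = uπ`, `u ∈ O^×` (memo (L1): an
  inertia element at `𝔭`, `ψ_𝔭/ψ_𝔭^ι ≡ 1 + 2π mod π²`, so `𝔡 = (π)`), then `π · splitHull e L ⊆ L`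
  (`smul_mem_of_mem_splitHull`): the chain `π S′ ⊆ T ⊆ S′` with `S′ := splitHull`.  For the `c`-FIXED PARTS
  (`plusPart`; memo (L2)–(L3): `γ_W = γ⁺_W ⊗ 1` generates `(T_W^O)⁺`) the chain persists
  (`smul_mem_plusPart_of_chain`, `plusPart_mono`), and between `π·(O v)` and `O v` there is NO intermediate
  module when `(π)` is maximal (`eq_span_or_eq_span_smul_of_isMaximal`; hence `exists_le_one_eq_span_pow_smul`:
  `T⁺ = O·π^a v` with `a ≤ 1` — the exponent `a_W ∈ {0, 1}` of memo (L3), the binder `ha : a ≤ 1` of the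
  kernel lemma `k2_transfer_of_split` of `Cruxes/EllipticUnitValueSevenOfGZK/KatoGenusResidueSketch.lean`),
  and two generators of one line differ by a unit (Mathlib `Submodule.span_singleton_eq_span_singleton`,
  re-exported as `exists_unit_smul_of_span_eq_span`: the binder `hzW : zW = u • π^a • zS`).
* **(D4) What is deliberately NOT here.**  The period map, `D_dR`, (15.8.1), `S(f)`, `S(ψ)` as objects; the
  memo's §5 corollary «(15.11.3) ⊗ K_𝔭 = (15.11.2), λ = 1» (inputs: Faltings' isogeny theorem — tree fact
  `faltings_tate_bijective` with the proved `exists_hom_ne_zero_of_faltings_tate_bijective`,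
  `AlgebraicGeometry/Motives/FaltingsAbelian.lean` —, functoriality of the Betti–étale and de Rham
  comparison isomorphisms under an isogeny, and the two uniqueness clauses = §3 here): it concerns the
  specific vectors `γ′ = (15.11.3)(e_B, 0)` and Kato's lattice `S′ = (15.11.2)(T_ψ ⊕ ιT_ψ)` of the route and is
  LEFT TO THE ROUTE-SIDE PORT (file F8 of the typing map, `Summits/…`), as the planner's row allows; the
  Iwasawa-cohomological frame ((15.12.1)–(15.16.1)) is the sibling `CMTwistedIwasawaModules.lean` (F7).
  No `instance`, no notation, no `sorry`; Mathlib-only imports (the file is frame-independent algebra and is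
  imported by F7/F8 without pulling the elliptic-curve tree).

## References

* K. Kato, Astérisque 295 (2004): §15.8 (pp. 256–257), §15.10 (p. 260), Lemma 15.11 and proof (pp. 260–262),
  remark p. 263. [Kato2004Asterisque]
* K. Ribet, *Galois representations attached to eigenforms with Nebentypus*, LNM 601 (1977) (Kato's [Ri2];
  input (i) of (D1) for general `k`; not used here).
* J.-P. Serre, *Abelian ℓ-adic representations and elliptic curves* (1968), IV.2.2 (CM case: the image
  commutes with the CM endomorphisms) — through the tree's `DivisionTowerAbelianOfRationalCMProofs.lean`.
  [Serre1968]
* J. Bellaïche, G. Chenevier, *Families of Galois representations and Selmer groups*, Astérisque 324 (2009),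
  §1.2 (lattices in residually multiplicity-free representations) — context for (D3). [BellaicheChenevier2009]
* Frozen memo `pub/bsd-cm/frozen/MEMO-bsd-cm-genus.v1.a38f3eedd2c92d58.md` §1 (N6), §4 (L1)–(L4), §5; typing
  map `Cruxes/EllipticUnitValueSevenOfGZK/GenusTypingMap-g57.md` REV 1.1 rows C3, C4; kernel
  `Cruxes/EllipticUnitValueSevenOfGZK/KatoGenusResidueSketch.lean` (`k2_transfer_of_split`).
-/

namespace Literature.NumberTheory.EllipticCurves.Kato2004.CMInduced

/-! ## §1 (Kato 15.10 in the elliptic-curve frame): the CM idempotent and the two eigenlines -/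

section Idempotent

variable {F : Type*} [Field F] {A : Type*} [Ring A] [Algebra F A]

/-- **The CM idempotent `e = (a − b)⁻¹ (G − b)`** attached to an operator `G` (the CM endomorphism
`T_p(φ) ⊗ 1` on `𝒱′ = V_pW ⊗ K_𝔭`) and an ordered pair `(a, b)` of scalars (the two roots of its characteristic
polynomial in `F = K_𝔭`, i.e. the two embeddings `K → K_𝔭`): the projector onto the `a`-eigenline
`𝒱′_ψ` along the `b`-eigenline `𝒱′_{ψ∘ι}` — Kato's decomposition `V_{L_λ}(f) = V_{L_λ}(ψ) ⊕ ιV_{L_λ}(ψ)` in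
the elliptic-curve frame (design (D2)). [cite: Kato2004Asterisque, §15.10 (p. 260)] -/
noncomputable def cmIdempotent (G : A) (a b : F) : A :=
  (a - b)⁻¹ • (G - algebraMap F A b)

/-- Unfolding `cmIdempotent`. [cite: Kato2004Asterisque, §15.10 (p. 260)] -/
theorem cmIdempotent_def (G : A) (a b : F) :
    cmIdempotent G a b = (a - b)⁻¹ • (G - algebraMap F A b) := rfl

/-- `1 − e = (a − b)⁻¹ (a − G)`: the complementary projector is the CM idempotent for the pair `(b, a)`.
[cite: Kato2004Asterisque, §15.10 (p. 260)] -/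
theorem one_sub_cmIdempotent (G : A) {a b : F} (hab : a ≠ b) :
    1 - cmIdempotent G a b = cmIdempotent G b a := by
  have h : (a - b) ≠ 0 := sub_ne_zero.mpr hab
  have h' : (b - a) ≠ 0 := sub_ne_zero.mpr (Ne.symm hab)
  rw [cmIdempotent_def, cmIdempotent_def]
  have key : (a - b)⁻¹ • (algebraMap F A a - algebraMap F A b) = (1 : A) := by
    rw [← map_sub, Algebra.algebraMap_eq_smul_one, smul_smul, inv_mul_cancel₀ h, one_smul]
  calc (1 : A) - (a - b)⁻¹ • (G - algebraMap F A b)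
      = (a - b)⁻¹ • (algebraMap F A a - algebraMap F A b) - (a - b)⁻¹ • (G - algebraMap F A b) := by
        rw [key]
    _ = (a - b)⁻¹ • (algebraMap F A a - G) := by rw [← smul_sub]; congr 1; abel
    _ = (b - a)⁻¹ • (G - algebraMap F A a) := by
        rw [show (a - b)⁻¹ = -(b - a)⁻¹ by rw [← neg_sub, neg_inv], neg_smul, ← smul_neg, neg_sub]

/-- **`e` is idempotent** when `G` is killed by `(X − a)(X − b)` with `a ≠ b` (Cayley–Hamilton for the CM
endomorphism: `G² − tG + n = 0`, `t = a + b`, `n = ab`).  Computation: `(G − a)(G − b) = 0` gives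
`(G − b)² = (a − b)(G − b)`. [cite: Kato2004Asterisque, §15.10 (p. 260)] -/
theorem cmIdempotent_isIdempotentElem {G : A} {a b : F} (hab : a ≠ b)
    (hG : (G - algebraMap F A a) * (G - algebraMap F A b) = 0) :
    IsIdempotentElem (cmIdempotent G a b) := by
  have h : (a - b) ≠ 0 := sub_ne_zero.mpr hab
  -- `(G - b)^2 = (a - b) • (G - b)`
  have sq : (G - algebraMap F A b) * (G - algebraMap F A b) = (a - b) • (G - algebraMap F A b) := by
    have : (G - algebraMap F A b) * (G - algebraMap F A b) =
        ((G - algebraMap F A a) + algebraMap F A (a - b)) * (G - algebraMap F A b) := by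
      congr 1; rw [map_sub]; abel
    rw [this, add_mul, hG, zero_add, ← Algebra.smul_def]
  rw [IsIdempotentElem, cmIdempotent_def, smul_mul_smul_comm, sq, smul_smul, mul_assoc,
    inv_mul_cancel₀ h, mul_one]

/-- The two factors of the characteristic polynomial of `G` commute (both are polynomials in `G`). [cite: Kato2004Asterisque, §15.10 (p. 260)] -/
theorem sub_algebraMap_mul_comm (G : A) (a b : F) :
    (G - algebraMap F A a) * (G - algebraMap F A b) = (G - algebraMap F A b) * (G - algebraMap F A a) := by
  simp only [sub_mul, mul_sub]
  rw [Algebra.commutes a G, Algebra.commutes b G, Algebra.commutes b (algebraMap F A a)]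
  abel

/-- **`G` acts on `range e` as the scalar `a`**: `G · e = a · e` (the line `𝒱′_ψ`, on which the CM field
acts through the first embedding). [cite: Kato2004Asterisque, §15.10 (p. 260)] -/
theorem mul_cmIdempotent {G : A} {a b : F}
    (hG : (G - algebraMap F A a) * (G - algebraMap F A b) = 0) :
    G * cmIdempotent G a b = a • cmIdempotent G a b := by
  have hGb : G * (G - algebraMap F A b) = a • (G - algebraMap F A b) := by
    have h0 : (G - algebraMap F A a) * (G - algebraMap F A b) = 0 := hG
    rw [sub_mul, sub_eq_zero, ← Algebra.smul_def] at h0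
    exact h0
  rw [cmIdempotent_def, mul_smul_comm, hGb, smul_comm]

/-- **`G` acts on `range (1 − e)` as the scalar `b`**: `G · (1 − e) = b · (1 − e)` (the conjugate line
`𝒱′_{ψ∘ι}`). [cite: Kato2004Asterisque, §15.10 (p. 260)] -/
theorem mul_one_sub_cmIdempotent {G : A} {a b : F} (hab : a ≠ b)
    (hG : (G - algebraMap F A a) * (G - algebraMap F A b) = 0) :
    G * (1 - cmIdempotent G a b) = b • (1 - cmIdempotent G a b) := by
  rw [one_sub_cmIdempotent G hab]
  refine mul_cmIdempotent ?_
  rw [← sub_algebraMap_mul_comm, hG]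

/-- **Operators commuting with `G` commute with `e`** (so `Gal(ℚ̄/K)`, which commutes with the CM
endomorphisms of a curve with `K`-rational CM, preserves both eigenlines).
[cite: Kato2004Asterisque, §15.10 (p. 260)] -/
theorem commute_cmIdempotent {G g : A} (a b : F) (hg : Commute g G) :
    Commute g (cmIdempotent G a b) := by
  rw [cmIdempotent_def]
  exact (hg.sub_right (Algebra.commute_algebraMap_right b g)).smul_right _

/-- **An operator `σ` with `σ G = (a + b − G) σ` conjugates `e` into `1 − e`**: `σ · e = (1 − e) · σ` — an
element of `Gal(ℚ̄/ℚ) ∖ Gal(ℚ̄/K)` (complex conjugation `ι`) carries the CM endomorphism `φ` to `φ̄` and hence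
SWAPS the two eigenlines: Kato's "`σ ∉ Gal(ℚ̄/K)` sends `(x, ιy)` to `((σι)(y), ι(ισ)(x))`".
[cite: Kato2004Asterisque, §15.10 (p. 260)] -/
theorem conj_cmIdempotent_of_anticommute {G σ : A} {a b : F} (hab : a ≠ b)
    (hσ : σ * G = (algebraMap F A (a + b) - G) * σ) :
    σ * cmIdempotent G a b = (1 - cmIdempotent G a b) * σ := by
  rw [one_sub_cmIdempotent G hab, cmIdempotent_def, cmIdempotent_def, mul_smul_comm, smul_mul_assoc,
    show (b - a)⁻¹ = -(a - b)⁻¹ by rw [← neg_sub, neg_inv], neg_smul, ← smul_neg]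
  congr 1
  rw [mul_sub, hσ, map_add, ← Algebra.commutes b σ]
  simp only [sub_mul, add_mul, neg_sub]
  abel

end Idempotent

section Eigenlines

variable {F : Type*} [Field F] {V : Type*} [AddCommGroup V] [Module F V]

/-- The two eigen-"lines" of an idempotent `e` are complementary: `𝒱′ = range e ⊕ ker e`
(Mathlib `LinearMap.IsIdempotentElem.isCompl`, re-exported in the vocabulary of this file).
[cite: Kato2004Asterisque, §15.10 (p. 260, "V_{L_λ}(ψ) ⊕ ιV_{L_λ}(ψ)")] -/
theorem isCompl_range_ker {e : V →ₗ[F] V} (he : IsIdempotentElem e) :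
    IsCompl (LinearMap.range e) (LinearMap.ker e) :=
  LinearMap.IsIdempotentElem.isCompl he

/-- `ker e = range (1 − e)` for an idempotent (Mathlib, re-exported). [cite: Kato2004Asterisque, §15.10 (p. 260)] -/
theorem ker_eq_range_one_sub {e : V →ₗ[F] V} (he : IsIdempotentElem e) :
    LinearMap.ker e = LinearMap.range (1 - e) :=
  LinearMap.IsIdempotentElem.ker_eq_range_one_sub he

/-- **An operator commuting with `e` preserves the `ψ`-line `range e`.** [cite: Kato2004Asterisque, §15.10 (p. 260)] -/
theorem map_range_le_of_commute {e g : V →ₗ[F] V} (hg : Commute g e) :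
    (LinearMap.range e).map g ≤ LinearMap.range e := by
  rintro _ ⟨_, ⟨x, rfl⟩, rfl⟩
  refine ⟨g x, ?_⟩
  change (e * g) x = (g * e) x
  rw [hg.eq]

/-- **An operator commuting with `e` preserves the conjugate line `ker e`.** [cite: Kato2004Asterisque, §15.10 (p. 260)] -/
theorem map_ker_le_of_commute {e g : V →ₗ[F] V} (hg : Commute g e) :
    (LinearMap.ker e).map g ≤ LinearMap.ker e := by
  rintro _ ⟨x, hx, rfl⟩
  have hx' : e x = 0 := hx
  change (e * g) x = 0
  rw [← hg.eq, Module.End.mul_apply, hx', map_zero]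

/-- **An operator `σ` with `σ e = (1 − e) σ` maps the `ψ`-line into the conjugate line** (`ι V_{L_λ}(ψ)`).
[cite: Kato2004Asterisque, §15.10 (p. 260)] -/
theorem map_range_le_ker_of_anticommute {e σ : V →ₗ[F] V} (he : IsIdempotentElem e)
    (hσ : σ * e = (1 - e) * σ) :
    (LinearMap.range e).map σ ≤ LinearMap.ker e := by
  rintro _ ⟨_, ⟨x, rfl⟩, rfl⟩
  rw [LinearMap.mem_ker]
  change (e * (σ * e)) x = 0
  rw [hσ, ← mul_assoc, mul_sub, mul_one, he.eq, sub_self, zero_mul, LinearMap.zero_apply]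

/-- … and the conjugate line into the `ψ`-line. [cite: Kato2004Asterisque, §15.10 (p. 260)] -/
theorem map_ker_le_range_of_anticommute {e σ : V →ₗ[F] V} (he : IsIdempotentElem e)
    (hσ : σ * e = (1 - e) * σ) :
    (LinearMap.ker e).map σ ≤ LinearMap.range e := by
  rintro _ ⟨x, hx, rfl⟩
  have hx' : e x = 0 := hx
  rw [LinearMap.IsIdempotentElem.mem_range_iff he]
  have h := congrArg (fun f : V →ₗ[F] V ↦ f x) hσ
  simp only [Module.End.mul_apply, hx', map_zero, LinearMap.sub_apply, Module.End.one_apply] at h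
  -- `0 = σ x - e (σ x)`
  exact (sub_eq_zero.mp h.symm).symm

end Eigenlines

/-! ## §2 The lattice chain `π S′ ⊆ T ⊆ S′` at the split vertex, plus-parts, and the exponent `a ∈ {0,1}`
(memo §4 (L1)–(L3); folklore) -/

section Lattice

variable {O : Type*} [CommRing O] {F : Type*} [Field F] [Algebra O F]
  {V : Type*} [AddCommGroup V] [Module F V] [Module O V] [IsScalarTower O F V]

/-- **The split hull `S′ = e(L) + (1 − e)(L)` of an `O`-lattice `L ⊆ 𝒱′`** (memo (L1): `M⁺ = pr_ψ L ⊕ pr_{cψ} L`,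
"homothetic to Kato's `Ind T_ψ = (15.11.2)(T_ψ ⊕ ιT_ψ)`"). [cite: Kato2004Asterisque, Lemma 15.11 (1) (p. 261, the lattice T_ψ ⊕ ιT_ψ of 15.13/15.17)] -/
def splitHull (e : V →ₗ[F] V) (L : Submodule O V) : Submodule O V :=
  L.map (e.restrictScalars O) ⊔ L.map ((1 - e).restrictScalars O)

/-- Unfolding `splitHull`. [cite: Kato2004Asterisque, Lemma 15.13 (2) (p. 264, the split lattice `T~ = T ⊕ ιT` of a stable lattice `T`) with §15.10 (p. 260)] -/
theorem splitHull_def (e : V →ₗ[F] V) (L : Submodule O V) :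
    splitHull e L = L.map (e.restrictScalars O) ⊔ L.map ((1 - e).restrictScalars O) := rfl

/-- `e(L) ⊆ S′`. [cite: Kato2004Asterisque, Lemma 15.13 (2) (p. 264, the split lattice `T~ = T ⊕ ιT` of a stable lattice `T`) with §15.10 (p. 260)] -/
theorem map_le_splitHull_left (e : V →ₗ[F] V) (L : Submodule O V) :
    L.map (e.restrictScalars O) ≤ splitHull e L := le_sup_left

/-- `(1 − e)(L) ⊆ S′`. [cite: Kato2004Asterisque, Lemma 15.13 (2) (p. 264, the split lattice `T~ = T ⊕ ιT` of a stable lattice `T`) with §15.10 (p. 260)] -/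
theorem map_le_splitHull_right (e : V →ₗ[F] V) (L : Submodule O V) :
    L.map ((1 - e).restrictScalars O) ≤ splitHull e L := le_sup_right

/-- **`L ⊆ S′`** (`x = e x + (1 − e) x`; memo (L1): `L ⊂ M⁺`). [cite: Kato2004Asterisque, Lemma 15.13 (2) (p. 264, the split lattice `T~ = T ⊕ ιT` of a stable lattice `T`) with §15.10 (p. 260)] -/
theorem le_splitHull (e : V →ₗ[F] V) (L : Submodule O V) : L ≤ splitHull e L := by
  intro x hx
  have hx' : x = e x + (1 - e) x := by simp
  rw [hx']
  exact Submodule.add_mem _ (map_le_splitHull_left e L ⟨x, hx, rfl⟩)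
    (map_le_splitHull_right e L ⟨x, hx, rfl⟩)

/-- Membership in the split hull: `x = e y + (1 − e) z` with `y, z ∈ L`. [cite: Kato2004Asterisque, Lemma 15.13 (2) (p. 264, the split lattice `T~ = T ⊕ ιT` of a stable lattice `T`) with §15.10 (p. 260)] -/
theorem mem_splitHull_iff (e : V →ₗ[F] V) (L : Submodule O V) (x : V) :
    x ∈ splitHull e L ↔ ∃ y ∈ L, ∃ z ∈ L, x = e y + (1 - e) z := by
  rw [splitHull, Submodule.mem_sup]
  constructor
  · rintro ⟨_, ⟨y, hy, rfl⟩, _, ⟨z, hz, rfl⟩, rfl⟩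
    exact ⟨y, hy, z, hz, rfl⟩
  · rintro ⟨y, hy, z, hz, rfl⟩
    exact ⟨_, ⟨y, hy, rfl⟩, _, ⟨z, hz, rfl⟩, rfl⟩

/-- **`S′` is split**: `e(S′) ⊆ S′` (indeed `e(S′) = e(L)` for an idempotent `e`). [cite: Kato2004Asterisque, Lemma 15.13 (2) (p. 264, the split lattice `T~ = T ⊕ ιT` of a stable lattice `T`) with §15.10 (p. 260)] -/
theorem map_splitHull_le_of_isIdempotentElem {e : V →ₗ[F] V} (he : IsIdempotentElem e)
    (L : Submodule O V) : (splitHull e L).map (e.restrictScalars O) ≤ splitHull e L := by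
  rintro _ ⟨x, hx, rfl⟩
  obtain ⟨y, hy, z, hz, rfl⟩ := (mem_splitHull_iff e L x).mp hx
  have h1 : e (e y) = e y := LinearMap.congr_fun he.eq y
  have h2 : e ((1 - e) z) = 0 := by
    have := LinearMap.congr_fun he.eq z
    simp only [Module.End.mul_apply] at this
    simp [this]
  change e (e y + (1 - e) z) ∈ splitHull e L
  rw [map_add, h1, h2, add_zero]
  exact map_le_splitHull_left e L ⟨y, hy, rfl⟩

/-- **`S′` is stable under every operator preserving `L` and commuting with `e`** (all of `Gal(ℚ̄/K)`).
[cite: Kato2004Asterisque, Lemma 15.13 (2) (p. 264, the split lattice `T~ = T ⊕ ιT` of a stable lattice `T`) with §15.10 (p. 260)] -/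
theorem map_splitHull_le_of_commute {e g : V →ₗ[F] V} (hg : Commute g e) {L : Submodule O V}
    (hgL : L.map (g.restrictScalars O) ≤ L) :
    (splitHull e L).map (g.restrictScalars O) ≤ splitHull e L := by
  rintro _ ⟨x, hx, rfl⟩
  obtain ⟨y, hy, z, hz, rfl⟩ := (mem_splitHull_iff e L x).mp hx
  have hge : ∀ v, g (e v) = e (g v) := fun v ↦ by
    change (g * e) v = (e * g) v; rw [hg.eq]
  have hg1e : ∀ v, g ((1 - e) v) = (1 - e) (g v) := fun v ↦ by
    simp only [LinearMap.sub_apply, Module.End.one_apply, map_sub, hge]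
  change g (e y + (1 - e) z) ∈ splitHull e L
  rw [map_add, hge, hg1e]
  exact Submodule.add_mem _ (map_le_splitHull_left e L ⟨g y, hgL ⟨y, hy, rfl⟩, rfl⟩)
    (map_le_splitHull_right e L ⟨g z, hgL ⟨z, hz, rfl⟩, rfl⟩)

/-- **`S′` is stable under an operator `σ` preserving `L` with `σ e = (1 − e) σ`** (complex conjugation:
it swaps the two summands, memo (L1) "`M⁺` is `c`-stable"). [cite: Kato2004Asterisque, Lemma 15.13 (2) (p. 264, the split lattice `T~ = T ⊕ ιT` of a stable lattice `T`) with §15.10 (p. 260)] -/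
theorem map_splitHull_le_of_anticommute {e σ : V →ₗ[F] V}
    (hσ : σ * e = (1 - e) * σ) {L : Submodule O V} (hσL : L.map (σ.restrictScalars O) ≤ L) :
    (splitHull e L).map (σ.restrictScalars O) ≤ splitHull e L := by
  rintro _ ⟨x, hx, rfl⟩
  obtain ⟨y, hy, z, hz, rfl⟩ := (mem_splitHull_iff e L x).mp hx
  have hσe : ∀ v, σ (e v) = (1 - e) (σ v) := fun v ↦ by
    change (σ * e) v = ((1 - e) * σ) v; rw [hσ]
  have hσ1e : ∀ v, σ ((1 - e) v) = e (σ v) := fun v ↦ by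
    -- `σ (1 - e) = σ - σ e = σ - (1 - e) σ = e σ`
    have := hσe v
    simp only [LinearMap.sub_apply, Module.End.one_apply, map_sub] at this ⊢
    rw [this]; abel
  change σ (e y + (1 - e) z) ∈ splitHull e L
  rw [map_add, hσe, hσ1e, add_comm]
  exact Submodule.add_mem _ (map_le_splitHull_left e L ⟨σ z, hσL ⟨z, hz, rfl⟩, rfl⟩)
    (map_le_splitHull_right e L ⟨σ y, hσL ⟨y, hy, rfl⟩, rfl⟩)

/-- **The one arithmetic input, as a hypothesis, and its consequence `(a − b)·e(L) ⊆ L`** (memo (L1):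
"for `l ∈ L` and `g ∈ G_K`: `g·l − ψ^ι(g)·l = (ψ(g) − ψ^ι(g))·e l ∈ L`, so `𝔡·pr_ψ L ⊂ L`"): if an
operator `g` preserves `L` and acts on the two lines by the scalars `a` (on `range e`) and `b ∈ O` (on
`ker e`), then `(a − b) • e x ∈ L` for every `x ∈ L`. [cite: Kato2004Asterisque, Lemma 15.13 (2) (p. 264, the split lattice `T~ = T ⊕ ιT` of a stable lattice `T`) with §15.10 (p. 260)] -/
theorem sub_smul_apply_mem {e g : V →ₗ[F] V} {L : Submodule O V}
    (hgL : L.map (g.restrictScalars O) ≤ L) {a : F} {b : O}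
    (hg : ∀ x, g x = a • e x + algebraMap O F b • (x - e x)) {x : V} (hx : x ∈ L) :
    (a - algebraMap O F b) • e x ∈ L := by
  have h : (a - algebraMap O F b) • e x = g x - algebraMap O F b • x := by
    rw [hg x, sub_smul, smul_sub]; abel
  rw [h, algebraMap_smul]
  exact Submodule.sub_mem _ (hgL ⟨x, hx, rfl⟩) (Submodule.smul_mem _ _ hx)

/-- Companion of `sub_smul_apply_mem` for the conjugate line: `(b − a) • (x − e x) ∈ L` when `a ∈ O`.
[cite: Kato2004Asterisque, Lemma 15.13 (2) (p. 264, the split lattice `T~ = T ⊕ ιT` of a stable lattice `T`) with §15.10 (p. 260)] -/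
theorem sub_smul_sub_apply_mem {e g : V →ₗ[F] V} {L : Submodule O V}
    (hgL : L.map (g.restrictScalars O) ≤ L) {a b : O}
    (hg : ∀ x, g x = algebraMap O F a • e x + algebraMap O F b • (x - e x)) {x : V} (hx : x ∈ L) :
    (algebraMap O F b - algebraMap O F a) • (x - e x) ∈ L := by
  have h : (algebraMap O F b - algebraMap O F a) • (x - e x) = g x - algebraMap O F a • x := by
    rw [hg x, sub_smul, smul_sub, smul_sub]; abel
  rw [h, algebraMap_smul]
  exact Submodule.sub_mem _ (hgL ⟨x, hx, rfl⟩) (Submodule.smul_mem _ _ hx)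

/-- **The chain `π·S′ ⊆ L ⊆ S′`** (memo (L1): `πM⁺ ⊂ M ⊂ L ⊂ M⁺`): if some operator `g` preserving the
lattice `L` acts on the two eigenlines by scalars `a, b ∈ O` with `a − b = u·π` for a unit `u` (the
inertia element at `𝔭` of the memo, `𝔡 = (π)`), then `π • x ∈ L` for every `x` in the split hull.
[cite: Kato2004Asterisque, Lemma 15.13 (2) (p. 264, the split lattice `T~ = T ⊕ ιT` of a stable lattice `T`) with §15.10 (p. 260)] -/
theorem smul_mem_of_mem_splitHull {e g : V →ₗ[F] V} {L : Submodule O V}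
    (hgL : L.map (g.restrictScalars O) ≤ L) {a b : O} {π : O} {u : Oˣ} (hab : a - b = u * π)
    (hg : ∀ x, g x = algebraMap O F a • e x + algebraMap O F b • (x - e x))
    {x : V} (hx : x ∈ splitHull e L) : π • x ∈ L := by
  obtain ⟨y, hy, z, hz, rfl⟩ := (mem_splitHull_iff e L x).mp hx
  -- on the `ψ`-line: `π • e y = u⁻¹ (a - b) • e y ∈ L`
  have h1 : π • e y ∈ L := by
    have h := sub_smul_apply_mem (e := e) hgL (a := algebraMap O F a) (b := b) hg hy
    rw [← map_sub, algebraMap_smul, hab] at h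
    have h' := Submodule.smul_mem L (↑u⁻¹ : O) h
    rwa [smul_smul, ← mul_assoc, Units.inv_mul, one_mul] at h'
  -- on the conjugate line: `π • (1 - e) z = -u⁻¹ (b - a) • (z - e z) ∈ L`
  have h2 : π • (1 - e) z ∈ L := by
    have h := sub_smul_sub_apply_mem (e := e) hgL hg hz
    rw [← map_sub, algebraMap_smul, show b - a = -(u * π) by rw [← hab]; ring] at h
    have h' := Submodule.smul_mem L (-(↑u⁻¹ : O)) h
    rw [smul_smul, show -(↑u⁻¹ : O) * -(↑u * π) = π by
      rw [neg_mul_neg, ← mul_assoc, Units.inv_mul, one_mul]] at h'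
    simpa only [LinearMap.sub_apply, Module.End.one_apply] using h'
  rw [smul_add]
  exact Submodule.add_mem _ h1 h2

/-- **The `c`-fixed part `N⁺ = {x ∈ N | s x = x}`** of an `O`-submodule `N` for an operator `s` (complex
conjugation `c` on `𝒱′`; memo (L2): `(S′)^{±}`, (L3): `(T_W^O)⁺ ∋ γ_W = γ⁺_W ⊗ 1`). [cite: Kato2004Asterisque, Lemma 15.13 (2) (p. 264, the split lattice `T~ = T ⊕ ιT` of a stable lattice `T`) with §15.10 (p. 260)] -/
def plusPart (s : V →ₗ[F] V) (N : Submodule O V) : Submodule O V :=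
  N ⊓ LinearMap.ker ((s - 1).restrictScalars O)

/-- Membership in `plusPart`. [cite: Kato2004Asterisque, Lemma 15.13 (2) (p. 264, the split lattice `T~ = T ⊕ ιT` of a stable lattice `T`) with §15.10 (p. 260)] -/
theorem mem_plusPart_iff (s : V →ₗ[F] V) (N : Submodule O V) (x : V) :
    x ∈ plusPart s N ↔ x ∈ N ∧ s x = x := by
  simp [plusPart, sub_eq_zero]

/-- `plusPart` is monotone in the module. [cite: Kato2004Asterisque, Lemma 15.13 (2) (p. 264, the split lattice `T~ = T ⊕ ιT` of a stable lattice `T`) with §15.10 (p. 260)] -/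
theorem plusPart_mono (s : V →ₗ[F] V) {N N' : Submodule O V} (h : N ≤ N') :
    plusPart s N ≤ plusPart s N' :=
  inf_le_inf_right _ h

/-- **The chain persists on plus-parts**: if `π • x ∈ T` for all `x ∈ N`, then `π • x ∈ T⁺` for all
`x ∈ N⁺` (memo (L2)–(L3): from `πS′_W ⊆ T_W^O ⊆ S′_W` to `π(S′_W)⁺ ⊆ (T_W^O)⁺ ⊆ (S′_W)⁺`). [cite: Kato2004Asterisque, Lemma 15.13 (2) (p. 264, the split lattice `T~ = T ⊕ ιT` of a stable lattice `T`) with §15.10 (p. 260)] -/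
theorem smul_mem_plusPart_of_chain (s : V →ₗ[F] V) {N T : Submodule O V} {π : O}
    (h : ∀ x ∈ N, π • x ∈ T) {x : V} (hx : x ∈ plusPart s N) : π • x ∈ plusPart s T := by
  rw [mem_plusPart_iff] at hx ⊢
  refine ⟨h x hx.1, ?_⟩
  rw [← algebraMap_smul F π x, map_smul, hx.2]

variable {M : Type*} [AddCommGroup M] [Module O M]

/-- **No module strictly between `π·(O v)` and `O v` when `(π)` is maximal**: an `O`-submodule `T` with
`π • v ∈ T ⊆ O ∙ v` is `O ∙ v` or `O ∙ (π • v)` (the ideal `{r | r • v ∈ T}` contains `(π)`, hence is `(π)`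
or `O`).  This is the dichotomy `a_W ∈ {0, 1}` of memo (L3). [cite: AtiyahMacdonald1969, Ch. 1, Prop. 1.2 and Cor. 1.4 (an ideal containing a maximal ideal is that ideal or the unit ideal)] -/
theorem eq_span_or_eq_span_smul_of_isMaximal {π : O} (hπ : (Ideal.span {π}).IsMaximal) {v : M}
    {T : Submodule O M} (h1 : π • v ∈ T) (h2 : T ≤ O ∙ v) :
    T = O ∙ v ∨ T = O ∙ (π • v) := by
  let J : Ideal O := T.comap (LinearMap.toSpanSingleton O M v)
  have hJ : ∀ r : O, r ∈ J ↔ r • v ∈ T := fun r ↦ by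
    simp [J, LinearMap.toSpanSingleton_apply]
  have hπJ : Ideal.span {π} ≤ J := by
    rw [Ideal.span_singleton_le_iff_mem, hJ]; exact h1
  by_cases hJtop : J = ⊤
  · left
    refine le_antisymm h2 ?_
    rw [Submodule.span_singleton_le_iff_mem, ← one_smul O v, ← hJ, hJtop]
    exact Submodule.mem_top
  · right
    have hJeq : Ideal.span {π} = J := hπ.eq_of_le hJtop hπJ
    refine le_antisymm ?_ ?_
    · intro t ht
      obtain ⟨r, rfl⟩ := Submodule.mem_span_singleton.mp (h2 ht)
      have hr : r ∈ Ideal.span {π} := by rw [hJeq, hJ]; exact ht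
      obtain ⟨s, rfl⟩ := Ideal.mem_span_singleton'.mp hr
      rw [mul_smul]
      exact Submodule.smul_mem _ _ (Submodule.mem_span_singleton_self _)
    · rw [Submodule.span_singleton_le_iff_mem]; exact h1

/-- **The exponent `a ∈ {0, 1}`**: under the same hypotheses `T = O ∙ (π^a • v)` for some `a ≤ 1` — the
binder `ha : a ≤ 1` of the kernel lemma `k2_transfer_of_split` (memo §4 LEMMA L). [cite: AtiyahMacdonald1969, Ch. 1, Prop. 1.2 and Cor. 1.4 (an ideal containing a maximal ideal is that ideal or the unit ideal)] -/
theorem exists_le_one_eq_span_pow_smul {π : O} (hπ : (Ideal.span {π}).IsMaximal) {v : M}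
    {T : Submodule O M} (h1 : π • v ∈ T) (h2 : T ≤ O ∙ v) :
    ∃ a : ℕ, a ≤ 1 ∧ T = O ∙ (π ^ a • v) := by
  rcases eq_span_or_eq_span_smul_of_isMaximal hπ h1 h2 with h | h
  · exact ⟨0, zero_le_one, by simpa using h⟩
  · exact ⟨1, le_rfl, by simpa using h⟩

/-- **Two generators of one line differ by a unit** (Mathlib `Submodule.span_singleton_eq_span_singleton`,
re-exported): over a domain, in a torsion-free module, `O ∙ w = O ∙ w′ → w = u • w′` for a unit `u` — the
binder `hzW : zW = u • π^a • zS` of `k2_transfer_of_split` once `(T_W^O)⁺ = O ∙ γ_W = O ∙ (π^a γ_{S′}⁺)`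
(memo (L3)). [cite: AtiyahMacdonald1969, Ch. 3, Prop. 3.8 context (generators of a cyclic torsion-free module over a domain differ by a unit)] -/
theorem exists_unit_smul_of_span_eq_span [IsDomain O] [Module.IsTorsionFree O M] {w w' : M}
    (h : O ∙ w = O ∙ w') : ∃ u : Oˣ, w = u • w' := by
  obtain ⟨u, hu⟩ := Submodule.span_singleton_eq_span_singleton.mp h.symm
  exact ⟨u, hu.symm⟩

end Lattice

/-! ## §3 The uniqueness mechanism of Lemma 15.11 (1)/(2): an equivariant map from a homogeneous set to a
torsor hits every point exactly once; isomorphisms of LINES form a torsor under the units -/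

section Mechanism

variable {U X Y : Type*} [Group U] [MulAction U X] [MulAction U Y]

/-- **Kato's proof of Lemma 15.11, abstractly.**  `X` = the `Gal(ℚ̄/ℚ)`-isomorphisms
`V_{L_λ}(ψ)~ ≅ V_{L_λ}(f)` (nonempty by 15.10; homogeneous under `U = L_λ^×` by Schur), `Y` = the isomorphisms
`S(ψ) ⊗ L_λ ≅ S(f) ⊗_F L_λ` of lines (a `U`-TORSOR), `D` = "apply `D^1_dR` and (15.8.1)" (equivariant); then for
the fixed `s` = (15.11.1) there is a UNIQUE `h ∈ X` with `D h = s` ("`c⁻¹h` is the desired one. The uniqueness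
follows from the irreducibility").  Clause (2) is the same with `Gal(ℂ/ℝ)` and `per`.
[cite: Kato2004Asterisque, Lemma 15.11 (1)(2) and proof (pp. 261–262)] -/
theorem existsUnique_of_equivariant (D : X → Y) (hD : ∀ (u : U) (x : X), D (u • x) = u • D x)
    [Nonempty X] (hX : ∀ x x' : X, ∃ u : U, x' = u • x)
    (hYfree : ∀ (u : U) (y : Y), u • y = y → u = 1) (hYtrans : ∀ y y' : Y, ∃ u : U, y' = u • y)
    (s : Y) : ∃! x : X, D x = s := by
  obtain ⟨x₀⟩ := ‹Nonempty X›
  -- existence: `D x₀ = c • s`, take `c⁻¹ • x₀`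
  obtain ⟨c, hc⟩ := hYtrans s (D x₀)
  refine ⟨c⁻¹ • x₀, ?_, fun x hx ↦ ?_⟩
  · show D (c⁻¹ • x₀) = s
    rw [hD, hc, inv_smul_smul]
  -- uniqueness: `x = u • (c⁻¹ • x₀)` and `D x = u • s = s` forces `u = 1`
  obtain ⟨u, rfl⟩ := hX (c⁻¹ • x₀) x
  rw [hD, hD, hc, inv_smul_smul] at hx
  rw [hYfree u s hx, one_smul]

variable {L : Type*} [Field L] {S₁ S₂ : Type*} [AddCommGroup S₁] [Module L S₁] [AddCommGroup S₂]
  [Module L S₂]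

/-- **Two isomorphisms onto a LINE differ by a unit scalar** ("which is `c` times the isomorphism induced by
(15.11.1) for some `c ∈ L_λ^×`"): if `finrank S₂ = 1`, for any two `L`-linear isomorphisms `h, h′ : S₁ ≅ S₂`
there is `c ∈ L^×` with `h′ = c • h` (transitivity of the torsor `Y` of `existsUnique_of_equivariant`).
[cite: Kato2004Asterisque, proof of Lemma 15.11 (1) (p. 261)] -/
theorem exists_unit_smul_eq_of_finrank_eq_one [Module.Free L S₂] (hS : Module.finrank L S₂ = 1)
    (h h' : S₁ ≃ₗ[L] S₂) : ∃ c : Lˣ, ∀ x, h' x = (c : L) • h x := by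
  obtain ⟨v, hv, hspan⟩ := finrank_eq_one_iff'.mp hS
  -- the automorphism `h' ∘ h⁻¹` of the line `S₂` is a scalar `c`
  obtain ⟨c, hc⟩ := hspan (h' (h.symm v))
  have hc0 : c ≠ 0 := by
    rintro rfl
    rw [zero_smul] at hc
    exact hv (by simpa using congrArg (fun y ↦ h (h'.symm y)) hc.symm)
  refine ⟨Units.mk0 c hc0, fun x ↦ ?_⟩
  obtain ⟨r, hr⟩ := hspan (h x)
  have hx : x = r • h.symm v := by
    apply h.injective
    rw [map_smul, LinearEquiv.apply_symm_apply, hr]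
  rw [Units.val_mk0, hx, map_smul, map_smul, LinearEquiv.apply_symm_apply, ← hc, smul_comm]

/-- **Units act FREELY on the isomorphisms onto a non-zero space**: `c • h = h` forces `c = 1` (the
freeness hypothesis of `existsUnique_of_equivariant` for the lines `S(f) ⊗ L_λ`, `V_L(f)^±`).
[cite: Kato2004Asterisque, proof of Lemma 15.11 (1)(2) (pp. 261–262)] -/
theorem unit_eq_one_of_smul_equiv_eq [Nontrivial S₂] (h : S₁ ≃ₗ[L] S₂) {c : Lˣ}
    (hc : ∀ x, (c : L) • h x = h x) : c = 1 := by
  obtain ⟨y, hy⟩ := exists_ne (0 : S₂)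
  have h1 := hc (h.symm y)
  rw [LinearEquiv.apply_symm_apply] at h1
  have h2 : ((c : L) - 1) • y = 0 := by rw [sub_smul, one_smul, h1, sub_self]
  rcases smul_eq_zero.mp h2 with h3 | h3
  · exact Units.ext (sub_eq_zero.mp h3)
  · exact absurd h3 hy

end Mechanism

end Literature.NumberTheory.EllipticCurves.Kato2004.CMInduced
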